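import Summits.FinalStateConjecture.FinalStateConjecture.Theses.SwallowTheDatum
import Summits.FinalStateConjecture.FinalStateConjecture.Theorems.SwallowTheDatumSubdataDevelopmentsEmbedMCGHD
import Summits.FinalStateConjecture.FinalStateConjecture.Theorems.SwallowTheDatumSubdataDevelopmentsEmbedRealise

/-!
# Route SwallowTheDatum · item `SubdataDevelopmentsEmbed` (stmt-FinalStateConjecture-10053) —
# the skeleton of the printed proof: the item from (1) local geometric uniqueness, (2) the
# domain-of-dependence sub-development, (3) "a maximal common sub-development of a maximal
# development is everything"

The route decl
`Summit.FinalStateConjecture.FinalStateConjecture.Theses.SwallowTheDatum.SubdataDevelopmentsEmbed`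
(every vacuum Cauchy development `𝒟'` of sub-data `D.comap Φ` embeds over `Φ` into every maximal
vacuum Cauchy development `𝒟` of `D`) is proved here from three displayed hypotheses, each a
self-contained statement over the prelude — the three constructions of the printed proof
(Choquet-Bruhat–Geroch, Comm. Math. Phys. 14 (1969), Thms. 2–3 and pp. 332–334; Hawking–Ellis 1973,
§7.5–7.6; Sbierski, Ann. Henri Poincaré 17 (2016) = arXiv:1309.7591, §3) that the tree cannot yet
carry, in the weakest form the composition needs:

1. `hloc` — **local geometric uniqueness** (Choquet-Bruhat–Geroch 1969, Thm. 2; Hawking–Ellis 1973,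
   §7.5, local Cauchy development theorem, uniqueness half; Sbierski 2016, Thm. 2.4 (ii): "for any
   two GHDs of the same initial data, there exists a CGHD"), verbatim over the prelude: any two
   vacuum Cauchy developments `𝒟₁, 𝒟₂` of the SAME data have a common sub-development
   `𝒰 ≼ 𝒟₁, 𝒰 ≼ 𝒟₂` (`CauchyDevelopment.EmbedsInto`). A PUBLISHED THEOREM (quasilinear hyperbolic
   PDE: uniqueness in wave gauge), not a restatement of the item; the natural next Literature fact
   of the Cauchy-problem files. It is turned into the realised form (`U ⊆ M₁`, `ψ : M₁ → M₂`) by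
   `exists_realised_of_embedsInto` (Sbierski, §2, Remark (2)).
2. `hdod` — **the domain of dependence develops the sub-data**: for a vacuum Cauchy development
   `𝒟` of `D` and `Φ` as in the item there are a vacuum Cauchy development `R` of `D.comap Φ` and
   a smooth, isometric, time-orientation preserving open embedding `χ : R → 𝒟` over `Φ`
   (`χ ∘ ι_R = ι ∘ Φ`). By `VacuumCauchyDevelopment.comapAlongRestrict` /
   `CauchyDevelopment.comapAlongRestrict_embeds` (`Literature/…/CauchyDevelopmentComap.lean`) this
   is exactly the existence of an open connected `V ⊆ M` containing `ι(Φ N)` in which `ι(Φ N)` is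
   a Cauchy hypersurface — causality theory of the Cauchy development of an open piece of a
   Cauchy hypersurface (Hawking–Ellis 1973, §6.5–6.6; O'Neill 1983, Ch. 14, Lemma 14.43).
3. `hmax` — **a maximal relative common sub-development of `𝒟'` and a MAXIMAL `𝒟` is all of
   `M'`**: the content of Sbierski 2016, Thm. 3.5 (= arXiv Thm. 12: a maximal common
   sub-development has no corresponding boundary points) together with the Hausdorff gluing
   `M ∪_ψ M'` (§3.2–3.3; Choquet-Bruhat–Geroch 1969, pp. 333–334; Hawking–Ellis 1973, pp. 250–251),
   which produces a vacuum Cauchy development of `D` extending `𝒟`, equal to `𝒟` by maximality.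

Composition (`subdataDevelopmentsEmbed_of_skeleton`): `hdod` and `hloc` (for the data
`D.comap Φ`, developments `𝒟'` and `R`) give one relative common sub-development `(U₀, χ ∘ ψ₀)`
of `𝒟'` and `𝒟` over `Φ`; `exists_maximal_relCGHD` (Zorn, this route's MCGHD file) a maximal one
`(U, ψ)`; `hmax` gives `U = M'`; then `ψ` is a time-orientation preserving isometric immersion of
`𝒟'` into `𝒟` over `Φ`, hence a smooth isometric open embedding over `Φ`
(`isOpenEmbedding_of_isIsometricImmersion_rel`, the relative Lemma 3.2 of Sbierski). Nothing is
assumed beyond the three displayed hypotheses; no definition, no named fact.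
-/

noncomputable section

open Function Set Filter Topology TopologicalSpace
open scoped Manifold ContDiff Topology

namespace Summit.FinalStateConjecture.FinalStateConjecture.Theorems

namespace SubdataDevelopmentsEmbed

open Literature.Geometry.Lorentzian

/-- **Item `SubdataDevelopmentsEmbed` from the three constructions of the printed proof** —
(1) local geometric uniqueness for vacuum Cauchy developments of the same data (Sbierski 2016,
Thm. 2.4 (ii); Choquet-Bruhat–Geroch 1969, Thm. 2: a common sub-development exists), (2) the
domain-of-dependence sub-development of a development over a sub-datum (Hawking–Ellis 1973,
§6.5–6.6), (3) a maximal relative common sub-development of a development of the sub-data and a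
MAXIMAL development of the data exhausts the former (Sbierski 2016, Thm. 3.5 with the gluing of
§3.2–3.3 and maximality) — composed through the Zorn-maximal relative common sub-development
(`exists_maximal_relCGHD`) and the relative embedding lemma
(`isOpenEmbedding_of_isIsometricImmersion_rel`). See the module docstring for the shape of each
hypothesis. -/
theorem subdataDevelopmentsEmbed_of_skeleton
    (hloc : ∀ (N : Type) [TopologicalSpace N] [ChartedSpace E3 N] [IsManifold (𝓡 3) ∞ N]
      [ConnectedSpace N] (D₁ : InitialDataSet (𝓡 3) N) (𝒟₁ 𝒟₂ : VacuumCauchyDevelopment D₁),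
      ∃ 𝒰 : VacuumCauchyDevelopment D₁,
        𝒰.toCauchyDevelopment.EmbedsInto 𝒟₁.toCauchyDevelopment ∧
          𝒰.toCauchyDevelopment.EmbedsInto 𝒟₂.toCauchyDevelopment)
    (hdod : ∀ (X : Type) [TopologicalSpace X] [ChartedSpace E3 X] [IsManifold (𝓡 3) ∞ X]
      [T2Space X] [SecondCountableTopology X] [ConnectedSpace X] (D : InitialDataSet (𝓡 3) X)
      (𝒟 : VacuumCauchyDevelopment D) (N : Type) [TopologicalSpace N] [ChartedSpace E3 N]
      [IsManifold (𝓡 3) ∞ N] [ConnectedSpace N] (Φ : N → X)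
      (hΦ : ContMDiff (𝓡 3) (𝓡 3) (∞ + 1) Φ) (hΦ' : ∀ u, Injective (mfderiv (𝓡 3) (𝓡 3) Φ u)),
      IsOpenEmbedding Φ →
      ∃ (R : VacuumCauchyDevelopment (D.comap Φ hΦ hΦ')) (χ : R.carrier → 𝒟.carrier),
        ContMDiff (𝓡 4) (𝓡 4) ∞ χ ∧ IsOpenEmbedding χ ∧
          R.metric.IsIsometricImmersion 𝒟.metric.toPseudoRiemannianMetric χ ∧
          R.timeOrientation.PreservesTimeOrientation χ 𝒟.timeOrientation ∧
          χ ∘ R.embed = 𝒟.embed ∘ Φ)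
    (hmax : ∀ (X : Type) [TopologicalSpace X] [ChartedSpace E3 X] [IsManifold (𝓡 3) ∞ X]
      [T2Space X] [SecondCountableTopology X] [ConnectedSpace X] (D : InitialDataSet (𝓡 3) X)
      (𝒟 : VacuumCauchyDevelopment D), 𝒟.IsMaximal →
      ∀ (N : Type) [TopologicalSpace N] [ChartedSpace E3 N] [IsManifold (𝓡 3) ∞ N]
      [ConnectedSpace N] (Φ : N → X) (hΦ : ContMDiff (𝓡 3) (𝓡 3) (∞ + 1) Φ)
      (hΦ' : ∀ u, Injective (mfderiv (𝓡 3) (𝓡 3) Φ u)), IsOpenEmbedding Φ →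
      ∀ (𝒟' : VacuumCauchyDevelopment (D.comap Φ hΦ hΦ')) (U : Opens 𝒟'.carrier)
        (ψ : 𝒟'.carrier → 𝒟.carrier),
        ((∀ u, 𝒟'.embed u ∈ U) ∧ IsConnected (U : Set 𝒟'.carrier) ∧
        (𝒟'.metric.restrict PseudoRiemannianMetric.contMDiff_restrict_holds U).IsCauchyHypersurface
          (𝒟'.timeOrientation.restrict PseudoRiemannianMetric.contMDiff_restrict_holds
            𝒟'.timeOrientation.contMDiff_restrict_holds U) (Subtype.val ⁻¹' range 𝒟'.embed) ∧
        ContMDiffOn (𝓡 4) (𝓡 4) ∞ ψ U ∧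
        (∀ p ∈ U, pullbackBilin (I := 𝓡 4) (I' := 𝓡 4) ψ 𝒟.metric.val p = 𝒟'.metric.val p) ∧
        (∀ p ∈ U, 𝒟.timeOrientation.IsFutureDirected
          (mfderiv (𝓡 4) (𝓡 4) ψ p (𝒟'.timeOrientation.vectorField p))) ∧
        ψ ∘ 𝒟'.embed = 𝒟.embed ∘ Φ) →
        (∀ (U' : Opens 𝒟'.carrier) (ψ' : 𝒟'.carrier → 𝒟.carrier),
          ((∀ u, 𝒟'.embed u ∈ U') ∧ IsConnected (U' : Set 𝒟'.carrier) ∧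
          (𝒟'.metric.restrict PseudoRiemannianMetric.contMDiff_restrict_holds
              U').IsCauchyHypersurface
            (𝒟'.timeOrientation.restrict PseudoRiemannianMetric.contMDiff_restrict_holds
              𝒟'.timeOrientation.contMDiff_restrict_holds U') (Subtype.val ⁻¹' range 𝒟'.embed) ∧
          ContMDiffOn (𝓡 4) (𝓡 4) ∞ ψ' U' ∧
          (∀ p ∈ U', pullbackBilin (I := 𝓡 4) (I' := 𝓡 4) ψ' 𝒟.metric.val p = 𝒟'.metric.val p) ∧
          (∀ p ∈ U', 𝒟.timeOrientation.IsFutureDirected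
            (mfderiv (𝓡 4) (𝓡 4) ψ' p (𝒟'.timeOrientation.vectorField p))) ∧
          ψ' ∘ 𝒟'.embed = 𝒟.embed ∘ Φ) →
          U ≤ U' → EqOn ψ ψ' U → U' = U) →
        U = ⊤) :
    Summit.FinalStateConjecture.FinalStateConjecture.Theses.SwallowTheDatum.SubdataDevelopmentsEmbed := by
  unfold Theses.SwallowTheDatum.SubdataDevelopmentsEmbed
  intro X _ _ _ _ _ _ D 𝒟 h𝒟 N _ _ _ _ Φ hΦ hΦ' hΦo 𝒟'
  -- (2) the domain-of-dependence sub-development `R` of `𝒟` over `Φ`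
  obtain ⟨R, χ, hχs, hχo, hχi, hχt, hχc⟩ := hdod X D 𝒟 N Φ hΦ hΦ' hΦo
  -- (1) local uniqueness for the data `D.comap Φ`: a common sub-development `𝒰` of `𝒟'` and
  -- `R`, realised inside `𝒟'` (Sbierski 2016, §2, Remark (2): `exists_realised_of_embedsInto`)
  obtain ⟨𝒰, h𝒰₁, h𝒰₂⟩ := hloc N (D.comap Φ hΦ hΦ') 𝒟' R
  obtain ⟨U₀, ψ₀, h1, h2, h3, h4, h5, h6, h7⟩ :=
    exists_realised_of_embedsInto 𝒟'.toCauchyDevelopment R.toCauchyDevelopment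
      𝒰.toCauchyDevelopment h𝒰₁ h𝒰₂
  have hχd : MDifferentiable (𝓡 4) (𝓡 4) χ := hχs.mdifferentiable (by simp)
  have hψ₀d : ∀ p ∈ U₀, MDifferentiableAt (𝓡 4) (𝓡 4) ψ₀ p := fun p hp ↦
    ((h4 p hp).contMDiffAt (U₀.2.mem_nhds hp)).mdifferentiableAt (by simp)
  -- the relative common sub-development `(U₀, χ ∘ ψ₀)` of `𝒟'` and `𝒟` over `Φ`
  have hP₀ : (∀ u, 𝒟'.embed u ∈ U₀) ∧ IsConnected (U₀ : Set 𝒟'.carrier) ∧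
      (𝒟'.metric.restrict PseudoRiemannianMetric.contMDiff_restrict_holds U₀).IsCauchyHypersurface
        (𝒟'.timeOrientation.restrict PseudoRiemannianMetric.contMDiff_restrict_holds
          𝒟'.timeOrientation.contMDiff_restrict_holds U₀) (Subtype.val ⁻¹' range 𝒟'.embed) ∧
      ContMDiffOn (𝓡 4) (𝓡 4) ∞ (χ ∘ ψ₀) U₀ ∧
      (∀ p ∈ U₀, pullbackBilin (I := 𝓡 4) (I' := 𝓡 4) (χ ∘ ψ₀) 𝒟.metric.val p =
        𝒟'.metric.val p) ∧
      (∀ p ∈ U₀, 𝒟.timeOrientation.IsFutureDirected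
        (mfderiv (𝓡 4) (𝓡 4) (χ ∘ ψ₀) p (𝒟'.timeOrientation.vectorField p))) ∧
      (χ ∘ ψ₀) ∘ 𝒟'.embed = 𝒟.embed ∘ Φ := by
    refine ⟨h1, h2, h3, hχs.comp_contMDiffOn h4, fun p hp ↦ ?_, fun p hp ↦ ?_, ?_⟩
    · -- isometric: `(χ ∘ ψ₀)^* g = ψ₀^* (χ^* g) = ψ₀^* g_R = g'` at `p`
      ext v w
      have hc := mfderiv_comp p (hχd (ψ₀ p)) (hψ₀d p hp)
      have hk := congrArg (fun b ↦ b (mfderiv (𝓡 4) (𝓡 4) ψ₀ p v) (mfderiv (𝓡 4) (𝓡 4) ψ₀ p w))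
        (hχi.2 (ψ₀ p))
      have hk' := congrArg (fun b ↦ b v w) (h5 p hp)
      simp only [pullbackBilin_apply] at hk hk' ⊢
      rw [hc]
      exact hk.trans hk'
    · -- time orientation: `dχ (dψ₀ T')` is future-directed
      rw [mfderiv_comp p (hχd (ψ₀ p)) (hψ₀d p hp)]
      exact hχt.isFutureDirected_mfderiv hχi.2 (h6 p hp)
    · rw [comp_assoc, h7, hχc]
  -- the Zorn-maximal relative common sub-development `(U, ψ)`
  obtain ⟨U, ψ, hP, hUmax⟩ :=
    exists_maximal_relCGHD 𝒟'.toCauchyDevelopment 𝒟.toCauchyDevelopment Φ ⟨U₀, χ ∘ ψ₀, hP₀⟩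
  -- (3) it is all of `M'`
  have hU : U = ⊤ := hmax X D 𝒟 h𝒟 N Φ hΦ hΦ' hΦo 𝒟' U ψ hP hUmax
  obtain ⟨-, -, -, hs, hi, ht, hc⟩ := hP
  rw [hU] at hs hi ht
  -- so `ψ` is a t.o.p. isometric immersion of `𝒟'` into `𝒟` over `Φ`, hence an open embedding
  have hiso : 𝒟'.metric.IsIsometricImmersion 𝒟.metric.toPseudoRiemannianMetric ψ :=
    ⟨contMDiffOn_univ.1 (by simpa using hs), fun p ↦ hi p trivial⟩
  have htop : 𝒟'.timeOrientation.PreservesTimeOrientation ψ 𝒟.timeOrientation :=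
    fun p ↦ ht p trivial
  exact ⟨ψ, isOpenEmbedding_of_isIsometricImmersion_rel 𝒟'.toCauchyDevelopment
    𝒟.toCauchyDevelopment hiso htop hΦo.injective hc⟩

end SubdataDevelopmentsEmbed

end Summit.FinalStateConjecture.FinalStateConjecture.Theorems

end
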